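import Literature.NumberTheory.Sieve.FriedlanderIwaniecPrimesDispersion
import Literature.NumberTheory.Sieve.FriedlanderIwaniecPrimesCoprimeCount
import Literature.NumberTheory.Sieve.FriedlanderIwaniecPrimesSectorTrivial
import HarnessLib

/-!
# Friedlander–Iwaniec, *The polynomial `X² + Y⁴` captures its primes*, §5 (5.21)–(5.25): `𝒟(M, N)` from `𝒟*(M, N)`

Family `parity`, statement parity.S17. Source: J. Friedlander, H. Iwaniec, Ann. of Math. (2) 148
(1998), 945–1040 [FriedlanderIwaniecAnnals1998], §5, (5.21)–(5.25): "Squaring out we get (5.21) …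
Here we want to insert the condition `(z₁, z₂) = 1` … we can do this at a small cost. … (5.22)
`𝒟(M, N) = 𝒟*(M, N) + O(τ² (M^{3/4} N^{3/4} + P⁻¹ M^{1/2} N^{3/2}) (log MN)^{516})`. Observe that the
first error term in (5.22) is admissible for (5.20) provided that (5.23) `τ ≤ x^{η/3}` … and the
second is admissible if (5.24) `P ≥ τ² (log x)^{2A+4A'+508}`. Under these conditions … it remains
to prove that (5.25) `𝒟*(M, N) ≪ ϑ² θ⁴ M^{1/2} N^{3/2} (log MN)⁸`."

Everything here is PROVED. This file carries out (5.21)–(5.25) on top of the crude Lemma 5.1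
(`FriedlanderIwaniecPrimesLemma51`) and the reindexing of the non-coprime pairs
(`FriedlanderIwaniecPrimesCoprimeCount`): it defines `𝒟*(M, N)` (`fiDispersionCoprime`) and the
parametrised statement (5.25) (`CoprimeDispersionBoundWith`, same shape as `DispersionBoundWith`
of `FriedlanderIwaniecPrimesDispersion`), and proves (5.20) ⇐ (5.25)
(`dispersionBoundWith_of_coprime`): in the regime of (5.15) both error terms of (5.22) are
eventually `≤ ϑ² θ⁴ M^{1/2} N^{3/2}`, the first because `(MN)^{3/4}/(M^{1/2} N^{3/2}) ≤ x^{-η}`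
((5.23) holds for `τ` a power of `log x`), the second because `log P ≥ (log log x)²` beats every
power of `log x` ((5.24)). With `bilinear515_of_dispersion` this puts (5.15) on (5.25).

## Contents

* `fiZWeight`, `fiZSet`, `fiSectorInner_eq_sum_zset` — the inner sum of (5.18) as `Σ_z b(z) 𝔷(Re w̄ z)`;
* `fiDispersionCoprime` (`𝒟*`), `CoprimeDispersionBoundWith` ((5.25) parametrised);
* `fiDispersion_sub_coprime`, `abs_fiDispersion_sub_coprime_le` (`|𝒟 - 𝒟*| ≤ τ² E`),
  `noncoprimeE_le` (`E ≤ Σ_j 2 log₂(2^{j+1} M₀) D(radM, radN)`, from `sum_noncoprime_le`);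
* `lemma51Count_block_le` (Lemma 5.1 at the scales of one dyadic block), `natLog_two_le`,
  `sum_Icc_inv_two_pow_le`, `eventually_log_rpow_le_rpow` ((5.23) automatic),
  `eventually_log_rpow_le_P` ((5.24) automatic), `FISectorRegime.of_le`,
  `CoprimeDispersionBoundWith.mono`;
* **`dispersionBoundWith_of_coprime`** ((5.20) ⇐ (5.25) with `K ↦ K + 1`, needs `A₁ ≤ 2B`),
  **`dispersion_of_coprime`** (quantified form, `B ↦ max B A₁`).

## References

* J. Friedlander, H. Iwaniec, Ann. of Math. (2) 148 (1998), 945–1040, §5 (5.21)–(5.25), Lemma 5.1.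
  [FriedlanderIwaniecAnnals1998]
-/

noncomputable section

open Filter Finset Real
open Literature.NumberTheory.QuadraticFields.GaussianPrimary

namespace Literature.NumberTheory.Sieve.FriedlanderIwaniecPrimes

/-! ### The inner sum of (5.18) over a set of Gaussian integers -/

/-- The weights `b(z) = β(|z|²) q(arg z)` of (5.13) (`β = fiBeta`, conventions (5.7)–(5.9) on the
ambient set). [cite: FriedlanderIwaniecAnnals1998, (5.13)] -/
def fiZWeight (q p : ℝ → ℝ) (C P τ : ℝ) (z : GaussianInt) : ℝ :=
  fiBeta p C P τ z.norm.natAbs * q (gaussArg z)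

/-- The `z` of (5.18): primary, `z ≡ z₀ (mod 8)`, `N' < |z|² ≤ (1+θ)N'`.
[cite: FriedlanderIwaniecAnnals1998, (5.7), (5.14)] -/
def fiZSet (z₀ : GaussianInt) (N' θ : ℝ) : Finset GaussianInt :=
  (Ioc ⌊N'⌋₊ ⌊(1 + θ) * N'⌋₊).biUnion fun n => (primaryNormEq n).filter (GaussCongrEight z₀)

/-- Membership in `fiZSet`. [folklore] -/
theorem mem_fiZSet {z₀ : GaussianInt} {N' θ : ℝ} {z : GaussianInt} :
    z ∈ fiZSet z₀ N' θ ↔ ∃ n ∈ Ioc ⌊N'⌋₊ ⌊(1 + θ) * N'⌋₊, z ∈ primaryNormEq n ∧ GaussCongrEight z₀ z := by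
  simp only [fiZSet, mem_biUnion, mem_filter]

/-- Basic facts on `z ∈ fiZSet`: `|z|² ∈ (⌊N'⌋, ⌊(1+θ)N'⌋]` and `z` is primary. [folklore] -/
theorem norm_of_mem_fiZSet {z₀ : GaussianInt} {N' θ : ℝ} {z : GaussianInt} (hz : z ∈ fiZSet z₀ N' θ) :
    z.norm.natAbs ∈ Ioc ⌊N'⌋₊ ⌊(1 + θ) * N'⌋₊ ∧ z.norm = z.norm.natAbs ∧ IsPrimary z := by
  obtain ⟨n, hn, hzn, -⟩ := mem_fiZSet.mp hz
  obtain ⟨hnorm, hprim⟩ := mem_primaryNormEq.mp hzn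
  have : z.norm.natAbs = n := by rw [hnorm, Int.natAbs_natCast]
  rw [this]
  exact ⟨hn, hnorm, hprim⟩

/-- **The inner sum of (5.18) as a sum over `z`**: `S(w) = Σ_{z ∈ fiZSet} b(z) 𝔷(Re w̄ z)`.
[cite: FriedlanderIwaniecAnnals1998, (5.18)] -/
theorem fiSectorInner_eq_sum_zset (q p : ℝ → ℝ) (z₀ : GaussianInt) (N' θ C P τ : ℝ)
    (w : GaussianInt) :
    fiSectorInner q p z₀ N' θ C P τ w =
      ∑ z ∈ fiZSet z₀ N' θ, fiZWeight q p C P τ z * (fiZeta (star w * z).re : ℝ) := by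
  unfold fiSectorInner fiZSet
  rw [sum_biUnion]
  · refine sum_congr rfl fun n _ => ?_
    rw [mul_sum]
    refine sum_congr rfl fun z hz => ?_
    have hzn : z.norm.natAbs = n := by
      rw [(mem_primaryNormEq.mp (mem_filter.mp hz).1).1, Int.natAbs_natCast]
    unfold fiZWeight
    rw [hzn]; ring
  · intro n _ n' _ hne
    refine disjoint_left.mpr fun z hz hz' => hne ?_
    have h1 := (mem_primaryNormEq.mp (mem_filter.mp hz).1).1
    have h2 := (mem_primaryNormEq.mp (mem_filter.mp hz').1).1
    exact_mod_cast h1.symm.trans h2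

/-! ### `𝒟*(M, N)` and (5.25) -/

/-- FI's `𝒟*(M, N)`: the dispersion sum (5.18) restricted to `(z₁, z₂) = 1`,
`Σ_w f(w) ΣΣ_{(z₁,z₂)=1} β_{z₁} β_{z₂} 𝔷(Re w̄ z₁) 𝔷(Re w̄ z₂)`, with the majorant `fiRad`.
[cite: FriedlanderIwaniecAnnals1998, (5.21)-(5.26)] -/
def fiDispersionCoprime (q p : ℝ → ℝ) (z₀ : GaussianInt) (M N' θ C P τ : ℝ) : ℝ :=
  ∑ m ∈ range (⌊4 * M⌋₊ + 1), fiRad M m * ∑ uv ∈ sqPairs m,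
    ∑ z₁ ∈ fiZSet z₀ N' θ, ∑ z₂ ∈ fiZSet z₀ N' θ,
      if GaussCoprime z₁ z₂ then
        (fiZWeight q p C P τ z₁ * (fiZeta (star (toGauss uv) * z₁).re : ℝ)) *
          (fiZWeight q p C P τ z₂ * (fiZeta (star (toGauss uv) * z₂).re : ℝ))
      else 0

/-- (5.25) in the regime `(η, A, A₁)` with the parameters `A', t, B` and the constant `K`: for all
large `x` and all data in the regime, `𝒟*(M, N) ≤ K ϑ² θ⁴ M^{1/2} N^{3/2} (log MN)⁸`. This is the
statement proved in §§6–26 of the source. [cite: FriedlanderIwaniecAnnals1998, (5.25)] -/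
def CoprimeDispersionBoundWith (η A A₁ A' t B K : ℝ) : Prop :=
  ∀ᶠ x : ℝ in atTop, ∀ P N M C N' : ℝ, FISectorRegime η A₁ B x P N M C N' →
    ∀ p : ℝ → ℝ, FICutoff (Real.log x ^ (-A')) N N' p →
    ∀ z₀ : GaussianInt, ∀ φ : ℝ, ∀ q : ℝ → ℝ,
      FISectorCutoff (Real.log x ^ (-A)) (Real.log x ^ (-A')) φ q →
      fiDispersionCoprime q p z₀ M N' (Real.log x ^ (-A')) C P (Real.log x ^ t) ≤
        K * (Real.log x ^ (-A)) ^ 2 * (Real.log x ^ (-A')) ^ 4 *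
          (M ^ (1 / 2 : ℝ) * N ^ (3 / 2 : ℝ)) * Real.log (M * N) ^ 8

/-! ### `𝒟 - 𝒟*` -/

/-- `𝒟 - 𝒟* = Σ_w f(w) ΣΣ_{(z₁,z₂) ≠ 1} β β 𝔷 𝔷`. [cite: FriedlanderIwaniecAnnals1998, (5.21)-(5.22)] -/
theorem fiDispersion_sub_coprime (q p : ℝ → ℝ) (z₀ : GaussianInt) (M N' θ C P τ : ℝ) :
    fiDispersion q p z₀ M N' θ C P τ - fiDispersionCoprime q p z₀ M N' θ C P τ =
      ∑ m ∈ range (⌊4 * M⌋₊ + 1), fiRad M m * ∑ uv ∈ sqPairs m,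
        ∑ z₁ ∈ fiZSet z₀ N' θ, ∑ z₂ ∈ fiZSet z₀ N' θ,
          if GaussCoprime z₁ z₂ then 0 else
            (fiZWeight q p C P τ z₁ * (fiZeta (star (toGauss uv) * z₁).re : ℝ)) *
              (fiZWeight q p C P τ z₂ * (fiZeta (star (toGauss uv) * z₂).re : ℝ)) := by
  unfold fiDispersion fiDispersionCoprime
  rw [← sum_sub_distrib]
  refine sum_congr rfl fun m _ => ?_
  rw [← mul_sub, ← sum_sub_distrib]
  congr 1
  refine sum_congr rfl fun uv _ => ?_
  rw [fiSectorInner_eq_sum_zset, sq, sum_mul_sum, ← sum_sub_distrib]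
  refine sum_congr rfl fun z₁ _ => ?_
  rw [← sum_sub_distrib]
  refine sum_congr rfl fun z₂ _ => ?_
  split_ifs <;> ring

/-- The good `z`: those with `b(z) ≠ 0`. [folklore] -/
def fiZGood (q p : ℝ → ℝ) (z₀ : GaussianInt) (N' θ C P τ : ℝ) : Finset GaussianInt :=
  (fiZSet z₀ N' θ).filter fun z => fiZWeight q p C P τ z ≠ 0

/-- The combinatorial error count `E = Σ_{1 ≤ |w|² ≤ 4M} ΣΣ_{good, (z₁,z₂) ≠ 1} 𝔷 𝔷`. [folklore] -/
def noncoprimeE (q p : ℝ → ℝ) (z₀ : GaussianInt) (M N' θ C P τ : ℝ) : ℕ :=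
  ∑ w ∈ (Icc 1 ⌊4 * M⌋₊).biUnion sqPairs,
    ∑ z₁ ∈ fiZGood q p z₀ N' θ C P τ, ∑ z₂ ∈ fiZGood q p z₀ N' θ C P τ,
      if GaussCoprime z₁ z₂ then 0 else
        fiZeta (star (toGauss w) * z₁).re * fiZeta (star (toGauss w) * z₂).re

/-- `|b(z)| ≤ τ` when `|p|, |q| ≤ 1` (on the support `τ(|z|²) ≤ τ`; elsewhere `b = 0`). [folklore] -/
theorem abs_fiZWeight_le {q p : ℝ → ℝ} (hq : ∀ u, |q u| ≤ 1) (hp : ∀ u, |p u| ≤ 1) (C P : ℝ) {τ : ℝ}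
    (hτ : 0 ≤ τ) (z : GaussianInt) : |fiZWeight q p C P τ z| ≤ τ := by
  unfold fiZWeight
  rw [abs_mul]
  set n := z.norm.natAbs
  by_cases h0 : fiBeta p C P τ n = 0
  · rw [h0, abs_zero, zero_mul]; exact hτ
  · have hsupp : ((ArithmeticFunction.sigma 0 n : ℕ) : ℝ) ≤ τ := by
      rw [fiBeta_def] at h0
      split_ifs at h0 with hc
      · exact hc.2
      · exact absurd rfl h0
    have h1 : |fiBeta p C P τ n| ≤ τ := by
      calc |fiBeta p C P τ n| ≤ |p n| * ((ArithmeticFunction.sigma 0 n : ℕ) : ℝ) := abs_fiBeta_le p C P τ n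
        _ ≤ 1 * τ := mul_le_mul (hp _) hsupp (Nat.cast_nonneg _) zero_le_one
        _ = τ := one_mul τ
    calc |fiBeta p C P τ n| * |q (gaussArg z)| ≤ τ * 1 :=
          mul_le_mul h1 (hq _) (abs_nonneg _) hτ
      _ = τ := mul_one τ

/-- **`|𝒟 - 𝒟*| ≤ τ² E`** (`f ∈ [0, 1]`, `f(0) = 0`, `|b| ≤ τ`, and the terms with `b = 0` vanish).
[cite: FriedlanderIwaniecAnnals1998, (5.21)-(5.22)] -/
theorem abs_fiDispersion_sub_coprime_le {q p : ℝ → ℝ} (hq : ∀ u, |q u| ≤ 1) (hp : ∀ u, |p u| ≤ 1)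
    (z₀ : GaussianInt) {M : ℝ} (hM : 0 < M) (N' θ C P : ℝ) {τ : ℝ} (hτ : 0 ≤ τ) :
    |fiDispersion q p z₀ M N' θ C P τ - fiDispersionCoprime q p z₀ M N' θ C P τ| ≤
      τ ^ 2 * (noncoprimeE q p z₀ M N' θ C P τ : ℝ) := by
  rw [fiDispersion_sub_coprime]
  set Z := fiZSet z₀ N' θ with hZ
  set G := fiZGood q p z₀ N' θ C P τ with hG
  set b := fiZWeight q p C P τ with hb
  -- the double sum over Z equals the double sum over the good z
  set F : ℤ × ℤ → GaussianInt → GaussianInt → ℝ := fun uv z₁ z₂ =>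
    if GaussCoprime z₁ z₂ then (0 : ℝ) else
      (b z₁ * (fiZeta (star (toGauss uv) * z₁).re : ℝ)) * (b z₂ * (fiZeta (star (toGauss uv) * z₂).re : ℝ))
    with hF
  have hFzero₁ : ∀ uv z₁ z₂, b z₁ = 0 → F uv z₁ z₂ = 0 := by
    intro uv z₁ z₂ h0; rw [hF]; simp only; split_ifs; · rfl
    · rw [h0]; ring
  have hFzero₂ : ∀ uv z₁ z₂, b z₂ = 0 → F uv z₁ z₂ = 0 := by
    intro uv z₁ z₂ h0; rw [hF]; simp only; split_ifs; · rfl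
    · rw [h0]; ring
  have hGdef : G = Z.filter fun z => b z ≠ 0 := rfl
  have hgood : ∀ uv : ℤ × ℤ, ∑ z₁ ∈ Z, ∑ z₂ ∈ Z, F uv z₁ z₂ = ∑ z₁ ∈ G, ∑ z₂ ∈ G, F uv z₁ z₂ := by
    intro uv
    rw [hGdef]
    symm
    calc ∑ z₁ ∈ Z.filter (fun z => b z ≠ 0), ∑ z₂ ∈ Z.filter (fun z => b z ≠ 0), F uv z₁ z₂
        = ∑ z₁ ∈ Z.filter (fun z => b z ≠ 0), ∑ z₂ ∈ Z, F uv z₁ z₂ := by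
          refine sum_congr rfl fun z₁ _ => ?_
          exact sum_filter_of_ne (s := Z) (p := fun z => b z ≠ 0) fun z₂ _ hne h0 => hne (hFzero₂ uv z₁ z₂ h0)
      _ = ∑ z₁ ∈ Z, ∑ z₂ ∈ Z, F uv z₁ z₂ := by
          refine sum_filter_of_ne (s := Z) (p := fun z => b z ≠ 0) fun z₁ _ hne h0 => hne ?_
          exact sum_eq_zero fun z₂ _ => hFzero₁ uv z₁ z₂ h0
  -- termwise bound
  set R : ℤ × ℤ → GaussianInt → GaussianInt → ℝ := fun uv z₁ z₂ =>
    if GaussCoprime z₁ z₂ then (0 : ℝ) else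
      ((fiZeta (star (toGauss uv) * z₁).re : ℝ) * (fiZeta (star (toGauss uv) * z₂).re : ℝ)) with hR
  have hterm : ∀ uv z₁ z₂, |F uv z₁ z₂| ≤ τ ^ 2 * R uv z₁ z₂ := by
    intro uv z₁ z₂
    rw [hF, hR]; simp only
    split_ifs
    · simp
    · rw [abs_mul, abs_mul, abs_mul, Nat.abs_cast, Nat.abs_cast]
      have h1 := abs_fiZWeight_le hq hp C P hτ z₁
      have h2 := abs_fiZWeight_le hq hp C P hτ z₂
      rw [← hb] at h1 h2
      have e : τ ^ 2 * ((fiZeta (star (toGauss uv) * z₁).re : ℝ) * (fiZeta (star (toGauss uv) * z₂).re : ℝ)) =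
          (τ * (fiZeta (star (toGauss uv) * z₁).re : ℝ)) * (τ * (fiZeta (star (toGauss uv) * z₂).re : ℝ)) := by ring
      rw [e]
      exact mul_le_mul (mul_le_mul_of_nonneg_right h1 (Nat.cast_nonneg _))
        (mul_le_mul_of_nonneg_right h2 (Nat.cast_nonneg _)) (by positivity) (by positivity)
  have hR0 : ∀ uv z₁ z₂, 0 ≤ R uv z₁ z₂ := by
    intro uv z₁ z₂; rw [hR]; simp only; split_ifs; · exact le_rfl
    · positivity
  -- the right-hand side in pushed form
  have hrhs : (noncoprimeE q p z₀ M N' θ C P τ : ℝ) =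
      ∑ m ∈ Icc 1 ⌊4 * M⌋₊, ∑ uv ∈ sqPairs m, ∑ z₁ ∈ G, ∑ z₂ ∈ G, R uv z₁ z₂ := by
    unfold noncoprimeE
    rw [← hG, sum_biUnion]
    · rw [hR]; push_cast
      refine sum_congr rfl fun m _ => sum_congr rfl fun uv _ => sum_congr rfl fun z₁ _ =>
        sum_congr rfl fun z₂ _ => ?_
      split_ifs <;> simp
    · intro m _ m' _ hne
      refine disjoint_left.mpr fun uv h1 h2 => hne ?_
      have e1 := mem_sqPairs.mp h1
      have e2 := mem_sqPairs.mp h2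
      exact_mod_cast e1.symm.trans e2
  rw [hrhs, mul_sum]
  -- split off m = 0 on the left
  have hsplit : range (⌊4 * M⌋₊ + 1) = insert 0 (Icc 1 ⌊4 * M⌋₊) := by
    ext m; simp only [mem_range, mem_insert, mem_Icc]; omega
  have hF' : ∀ uv : ℤ × ℤ, ∑ z₁ ∈ Z, ∑ z₂ ∈ Z, (if GaussCoprime z₁ z₂ then (0 : ℝ) else
      (b z₁ * (fiZeta (star (toGauss uv) * z₁).re : ℝ)) *
        (b z₂ * (fiZeta (star (toGauss uv) * z₂).re : ℝ))) =
      ∑ z₁ ∈ G, ∑ z₂ ∈ G, F uv z₁ z₂ := by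
    intro uv; rw [← hgood uv]
  simp_rw [hF']
  rw [hsplit, sum_insert (by simp), Nat.cast_zero, fiRad_eq_zero_of_le hM (by linarith), zero_mul, zero_add]
  refine (abs_sum_le_sum_abs _ _).trans (sum_le_sum fun m _ => ?_)
  rw [abs_mul, abs_of_nonneg (fiRad_nonneg M m), mul_sum]
  calc fiRad M m * |∑ uv ∈ sqPairs m, ∑ z₁ ∈ G, ∑ z₂ ∈ G, F uv z₁ z₂|
      ≤ 1 * ∑ uv ∈ sqPairs m, ∑ z₁ ∈ G, ∑ z₂ ∈ G, |F uv z₁ z₂| := by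
        refine mul_le_mul (fiRad_le_one M m) ?_ (abs_nonneg _) zero_le_one
        refine (abs_sum_le_sum_abs _ _).trans (sum_le_sum fun uv _ => ?_)
        refine (abs_sum_le_sum_abs _ _).trans (sum_le_sum fun z₁ _ => ?_)
        exact abs_sum_le_sum_abs _ _
    _ ≤ ∑ uv ∈ sqPairs m, τ ^ 2 * ∑ z₁ ∈ G, ∑ z₂ ∈ G, R uv z₁ z₂ := by
        rw [one_mul]
        refine sum_le_sum fun uv _ => ?_
        rw [mul_sum]
        refine sum_le_sum fun z₁ _ => ?_
        rw [mul_sum]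
        exact sum_le_sum fun z₂ _ => hterm uv z₁ z₂

/-! ### The good `z` satisfy the hypotheses of `sum_noncoprime_le` -/

/-- **The good `z`** are nonzero, primitive, with odd squarefree norm `≤ ⌊(1+θ)N'⌋` free of prime
factors `< ⌈P⌉` (support of `β`, (5.7)–(5.9)). [cite: FriedlanderIwaniecAnnals1998, (5.7)-(5.9)] -/
theorem fiZGood_hyps (q p : ℝ → ℝ) (z₀ : GaussianInt) (N' θ C P τ : ℝ) :
    ∀ z ∈ fiZGood q p z₀ N' θ C P τ, z ≠ 0 ∧ z.norm.natAbs ≤ ⌊(1 + θ) * N'⌋₊ ∧ z.norm.natAbs % 2 = 1 ∧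
      Squarefree z.norm.natAbs ∧ Int.gcd z.re z.im = 1 ∧
      ∀ r ∈ z.norm.natAbs.primeFactors, ⌈P⌉₊ ≤ r := by
  intro z hz
  unfold fiZGood at hz
  obtain ⟨hzZ, hb⟩ := mem_filter.mp hz
  obtain ⟨hn, hnorm, hprim⟩ := norm_of_mem_fiZSet hzZ
  set n := z.norm.natAbs with hndef
  have hβ : fiBeta p C P τ n ≠ 0 := by
    intro h0; apply hb; unfold fiZWeight; rw [← hndef, h0, zero_mul]
  have hsq : Squarefree n := squarefree_of_fiBeta_ne_zero hβ
  have hsupp : ∀ r ∈ n.primeFactors, P ≤ (r : ℝ) := by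
    rw [fiBeta_def] at hβ
    split_ifs at hβ with hc
    · exact hc.1
    · exact absurd rfl hβ
  refine ⟨hprim.ne_zero, (mem_Ioc.mp hn).2, ?_, hsq, ?_, ?_⟩
  · have h := hprim.norm_odd
    rw [hnorm] at h
    exact_mod_cast h
  · exact Int.isCoprime_iff_gcd_eq_one.mp (isCoprime_re_im_of_squarefree hnorm hsq)
  · intro r hr
    exact Nat.ceil_le.mpr (hsupp r hr)

/-- **`E ≤ Σ_j 2 log₂(2^{j+1} M₀) · D(radM M₀ j, radN N₀ j)`**, `M₀ = ⌊4M⌋`, `N₀ = ⌊(1+θ)N'⌋`,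
`j` from `log₂ ⌈P⌉` to `log₂ N₀` (`sum_noncoprime_le`). [cite: FriedlanderIwaniecAnnals1998, §5, proof of (5.22)] -/
theorem noncoprimeE_le (q p : ℝ → ℝ) (z₀ : GaussianInt) (M N' θ C P τ : ℝ) :
    noncoprimeE q p z₀ M N' θ C P τ ≤
      ∑ j ∈ Icc (Nat.log 2 ⌈P⌉₊) (Nat.log 2 ⌊(1 + θ) * N'⌋₊),
        2 * Nat.log 2 (2 ^ (j + 1) * ⌊4 * M⌋₊) * lemma51Count (radM ⌊4 * M⌋₊ j) (radN ⌊(1 + θ) * N'⌋₊ j) :=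
  sum_noncoprime_le _ _ _ _ (fiZGood_hyps q p z₀ N' θ C P τ)

/-! ### Lemma 5.1 on one dyadic block -/

/-- `(a + 1)³ ≤ 4 (a³ + 1)` for `a ≥ 0`. [folklore] -/
theorem add_one_pow_three_le {a : ℝ} (ha : 0 ≤ a) : (a + 1) ^ 3 ≤ 4 * (a ^ 3 + 1) := by
  nlinarith [mul_nonneg (sq_nonneg (a - 1)) (by linarith : 0 ≤ a + 1)]

/-- `(25 √P)^{3/2} = 125 P^{3/4}` for `P ≥ 0`. [folklore] -/
theorem rpow_twentyfive_sqrt {P : ℝ} (hP : 0 ≤ P) :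
    (25 * Real.sqrt P) ^ (3 / 2 : ℝ) = 125 * P ^ (3 / 4 : ℝ) := by
  rw [Real.mul_rpow (by norm_num) (Real.sqrt_nonneg P), Real.sqrt_eq_rpow, ← Real.rpow_mul hP]
  congr 1
  · rw [show (25 : ℝ) = 5 ^ (2 : ℝ) by norm_num, ← Real.rpow_mul (by norm_num),
      show (2 : ℝ) * (3 / 2) = ((3 : ℕ) : ℝ) by norm_num, Real.rpow_natCast]
    norm_num
  · norm_num

/-- `log 25 ≤ 4`. [folklore] -/
theorem log_twentyfive_le : Real.log 25 ≤ 4 := by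
  have h5 : Real.log 5 ≤ 2 := by
    rw [Real.log_le_iff_le_exp (by norm_num)]
    have := Real.quadratic_le_exp_of_nonneg (show (0 : ℝ) ≤ 2 by norm_num)
    linarith
  have : Real.log 25 = Real.log 5 + Real.log 5 := by
    rw [← Real.log_mul (by norm_num) (by norm_num)]; norm_num
  linarith

/-- **Lemma 5.1 at the scales of block `j`**: for `1 ≤ N ≤ M`, `M₀ ≤ 4M`, `N₀ ≤ 4N`,
`N₀ ≤ 2^{j+1} M₀`, `2^j ≤ 4N`:
`D(radM M₀ j, radN N₀ j) ≤ K₅ ((MN)^{3/4} + M^{1/2} N^{3/2}/2^j) (1 + log MN)^κ`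
(the source's `D(M P₁, N/P₁) ≪ ((MN)^{3/4} + P₁⁻¹ M^{1/2} N^{3/2}) (log MN)^{514}`).
[cite: FriedlanderIwaniecAnnals1998, Lemma 5.1, proof of (5.22)] -/
theorem lemma51Count_block_le : ∃ K₅ : ℝ, 0 < K₅ ∧ ∃ κ : ℕ, ∀ M N : ℝ, 1 ≤ N → N ≤ M →
    ∀ M₀ N₀ j : ℕ, (M₀ : ℝ) ≤ 4 * M → (N₀ : ℝ) ≤ 4 * N → N₀ ≤ 2 ^ (j + 1) * M₀ → (2 : ℝ) ^ j ≤ 4 * N →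
      (lemma51Count (radM M₀ j) (radN N₀ j) : ℝ) ≤
        K₅ * ((M * N) ^ (3 / 4 : ℝ) + M ^ (1 / 2 : ℝ) * N ^ (3 / 2 : ℝ) / 2 ^ j) *
          (1 + Real.log (M * N)) ^ κ := by
  obtain ⟨K, hK, κ, hL51⟩ := lemma51Count_le
  refine ⟨192 * 5 ^ κ * K, by positivity, κ, ?_⟩
  intro M N hN hNM M₀ N₀ j hM₀ hN₀ hNM₀ h2j
  have hM : 1 ≤ M := hN.trans hNM
  set RM := radM M₀ j with hRMdef
  set RN := radN N₀ j with hRNdef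
  have hRN1 : 1 ≤ RN := Nat.le_add_left 1 _
  have hRNM : RN ≤ RM := by
    rw [hRNdef, hRMdef, radN, radM]
    exact Nat.succ_le_succ (Nat.sqrt_le_sqrt ((Nat.div_le_self _ _).trans hNM₀))
  have h := hL51 RM RN hRN1 hRNM
  -- real quantities
  set Pm : ℝ := M * N with hPm
  have hP1 : 1 ≤ Pm := by rw [hPm]; nlinarith
  have hP0 : 0 ≤ Pm := by linarith
  have h2j0 : (0 : ℝ) < 2 ^ j := by positivity
  set S : ℝ := Real.sqrt (8 * M * 2 ^ j) with hS
  set a : ℝ := Real.sqrt (4 * N / 2 ^ j) with ha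
  have ha0 : 0 ≤ a := Real.sqrt_nonneg _
  have hS1 : 1 ≤ S := by
    rw [hS, show (1 : ℝ) = Real.sqrt 1 from Real.sqrt_one.symm]
    refine Real.sqrt_le_sqrt ?_
    have : (1 : ℝ) ≤ 2 ^ j := one_le_pow₀ (by norm_num)
    nlinarith
  have hS0 : 0 ≤ S := by linarith
  have hsqP1 : 1 ≤ Real.sqrt Pm := by
    rw [show (1 : ℝ) = Real.sqrt 1 from Real.sqrt_one.symm]; exact Real.sqrt_le_sqrt hP1
  -- RM ≤ 2 S, RN ≤ a + 1
  have hRM : (RM : ℝ) ≤ 2 * S := by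
    rw [hRMdef, radM]; push_cast
    have h1 : ((Nat.sqrt (2 ^ (j + 1) * M₀) : ℕ) : ℝ) ≤ Real.sqrt (((2 ^ (j + 1) * M₀ : ℕ) : ℝ)) :=
      Real.nat_sqrt_le_real_sqrt
    have h2 : Real.sqrt (((2 ^ (j + 1) * M₀ : ℕ) : ℝ)) ≤ S := by
      rw [hS]; refine Real.sqrt_le_sqrt ?_; push_cast
      rw [pow_succ]
      nlinarith [mul_le_mul_of_nonneg_left hM₀ (by positivity : (0 : ℝ) ≤ 2 ^ j)]
    linarith
  have hRNle : (RN : ℝ) ≤ a + 1 := by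
    rw [hRNdef, radN]; push_cast
    have h1 : ((Nat.sqrt (N₀ / 2 ^ j) : ℕ) : ℝ) ≤ Real.sqrt (((N₀ / 2 ^ j : ℕ) : ℝ)) :=
      Real.nat_sqrt_le_real_sqrt
    have h2 : Real.sqrt (((N₀ / 2 ^ j : ℕ) : ℝ)) ≤ a := by
      rw [ha]; refine Real.sqrt_le_sqrt ?_
      calc (((N₀ / 2 ^ j : ℕ)) : ℝ) ≤ (N₀ : ℝ) / ((2 ^ j : ℕ) : ℝ) := Nat.cast_div_le
        _ = (N₀ : ℝ) / 2 ^ j := by push_cast; ring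
        _ ≤ 4 * N / 2 ^ j := div_le_div_of_nonneg_right hN₀ h2j0.le
    linarith
  -- S a ≤ 6 √P, S ≤ 6 √P
  have h32 : Real.sqrt 32 ≤ 6 := by rw [Real.sqrt_le_left (by norm_num)]; norm_num
  have hSa : S * a ≤ 6 * Real.sqrt Pm := by
    rw [hS, ha, ← Real.sqrt_mul (by positivity)]
    have : 8 * M * 2 ^ j * (4 * N / 2 ^ j) = 32 * Pm := by
      rw [hPm]; field_simp; ring
    rw [this, Real.sqrt_mul (by norm_num)]
    exact mul_le_mul_of_nonneg_right h32 (Real.sqrt_nonneg _)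
  have hSle : S ≤ 6 * Real.sqrt Pm := by
    calc S ≤ Real.sqrt (32 * Pm) := by
          rw [hS]; refine Real.sqrt_le_sqrt ?_; rw [hPm]; nlinarith
      _ = Real.sqrt 32 * Real.sqrt Pm := Real.sqrt_mul (by norm_num) _
      _ ≤ 6 * Real.sqrt Pm := mul_le_mul_of_nonneg_right h32 (Real.sqrt_nonneg _)
  -- RM RN ≤ 25 √P, RM RN³ ≤ 192 √P N / 2^j + 48 √P
  have hRM0 : (0 : ℝ) ≤ RM := Nat.cast_nonneg _
  have hRN0 : (0 : ℝ) ≤ RN := Nat.cast_nonneg _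
  have hprod : (RM : ℝ) * RN ≤ 25 * Real.sqrt Pm := by
    calc (RM : ℝ) * RN ≤ (2 * S) * (a + 1) := mul_le_mul hRM hRNle hRN0 (by positivity)
      _ = 2 * (S * a) + 2 * S := by ring
      _ ≤ 2 * (6 * Real.sqrt Pm) + 2 * (6 * Real.sqrt Pm) := by linarith
      _ ≤ 25 * Real.sqrt Pm := by linarith
  have hprod1 : (1 : ℝ) ≤ (RM : ℝ) * RN := by
    have h1 : (1 : ℝ) ≤ RM := by exact_mod_cast hRN1.trans hRNM
    have h2 : (1 : ℝ) ≤ RN := by exact_mod_cast hRN1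
    nlinarith
  have ha2 : a ^ 2 = 4 * N / 2 ^ j := by rw [ha, Real.sq_sqrt (by positivity)]
  have hcube : (RM : ℝ) * (RN : ℝ) ^ 3 ≤ 192 * (Real.sqrt Pm * N) / 2 ^ j + 48 * Real.sqrt Pm := by
    calc (RM : ℝ) * (RN : ℝ) ^ 3 ≤ (2 * S) * (a + 1) ^ 3 :=
          mul_le_mul hRM (pow_le_pow_left₀ hRN0 hRNle 3) (by positivity) (by positivity)
      _ ≤ (2 * S) * (4 * (a ^ 3 + 1)) := mul_le_mul_of_nonneg_left (add_one_pow_three_le ha0) (by positivity)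
      _ = 8 * (S * a) * a ^ 2 + 8 * S := by ring
      _ ≤ 8 * (6 * Real.sqrt Pm) * (4 * N / 2 ^ j) + 8 * (6 * Real.sqrt Pm) := by
          rw [ha2]
          have : 0 ≤ 4 * N / 2 ^ j := by positivity
          nlinarith [mul_le_mul_of_nonneg_right hSa this]
      _ = 192 * (Real.sqrt Pm * N) / 2 ^ j + 48 * Real.sqrt Pm := by ring
  -- powers
  have h32' : ((RM : ℝ) * RN) ^ (3 / 2 : ℝ) ≤ 125 * Pm ^ (3 / 4 : ℝ) := by
    rw [← rpow_twentyfive_sqrt hP0]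
    exact Real.rpow_le_rpow (by positivity) hprod (by norm_num)
  have hsqrtP : Real.sqrt Pm ≤ Pm ^ (3 / 4 : ℝ) := by
    rw [Real.sqrt_eq_rpow]
    exact Real.rpow_le_rpow_of_exponent_le hP1 (by norm_num)
  have hMN : Real.sqrt Pm * N = M ^ (1 / 2 : ℝ) * N ^ (3 / 2 : ℝ) := by
    rw [hPm, Real.sqrt_mul (by linarith), Real.sqrt_eq_rpow, Real.sqrt_eq_rpow,
      show (3 / 2 : ℝ) = 1 / 2 + 1 by norm_num, Real.rpow_add (by linarith), Real.rpow_one]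
    ring
  -- the logarithm
  have hlogP : 0 ≤ Real.log Pm := Real.log_nonneg hP1
  have hlog : 1 + Real.log ((RM : ℝ) * RN) ≤ 5 * (1 + Real.log Pm) := by
    have h1 : Real.log ((RM : ℝ) * RN) ≤ Real.log (25 * Real.sqrt Pm) :=
      Real.log_le_log (by linarith) hprod
    have h2 : Real.log (25 * Real.sqrt Pm) = Real.log 25 + Real.log Pm / 2 := by
      rw [Real.log_mul (by norm_num) (by linarith), Real.log_sqrt hP0]
    have := log_twentyfive_le
    linarith
  have hlog0 : 0 ≤ 1 + Real.log ((RM : ℝ) * RN) := by linarith [Real.log_nonneg hprod1]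
  have hlogκ : (1 + Real.log ((RM : ℝ) * RN)) ^ κ ≤ 5 ^ κ * (1 + Real.log Pm) ^ κ := by
    rw [← mul_pow]; exact pow_le_pow_left₀ hlog0 hlog κ
  -- combine
  have hA0 : 0 ≤ Pm ^ (3 / 4 : ℝ) := by positivity
  have hB0 : 0 ≤ M ^ (1 / 2 : ℝ) * N ^ (3 / 2 : ℝ) / 2 ^ j := by positivity
  have hmain : ((RM : ℝ) * RN) ^ (3 / 2 : ℝ) + RM * (RN : ℝ) ^ 3 ≤
      192 * (Pm ^ (3 / 4 : ℝ) + M ^ (1 / 2 : ℝ) * N ^ (3 / 2 : ℝ) / 2 ^ j) := by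
    rw [hMN] at hcube
    have : 48 * Real.sqrt Pm ≤ 48 * Pm ^ (3 / 4 : ℝ) := by linarith
    have e : 192 * (M ^ (1 / 2 : ℝ) * N ^ (3 / 2 : ℝ)) / 2 ^ j = 192 * (M ^ (1 / 2 : ℝ) * N ^ (3 / 2 : ℝ) / 2 ^ j) := by
      ring
    linarith
  calc (lemma51Count RM RN : ℝ)
      ≤ K * (((RM : ℝ) * RN) ^ (3 / 2 : ℝ) + RM * (RN : ℝ) ^ 3) * (1 + Real.log ((RM : ℝ) * RN)) ^ κ := h
    _ ≤ K * (192 * (Pm ^ (3 / 4 : ℝ) + M ^ (1 / 2 : ℝ) * N ^ (3 / 2 : ℝ) / 2 ^ j)) *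
          (5 ^ κ * (1 + Real.log Pm) ^ κ) := by
        refine mul_le_mul (mul_le_mul_of_nonneg_left hmain hK.le) hlogκ (pow_nonneg hlog0 κ) ?_
        positivity
    _ = 192 * 5 ^ κ * K * (Pm ^ (3 / 4 : ℝ) + M ^ (1 / 2 : ℝ) * N ^ (3 / 2 : ℝ) / 2 ^ j) *
          (1 + Real.log Pm) ^ κ := by ring

/-! ### Elementary and eventual inequalities for the regime -/

/-- `log₂ n ≤ 2 log n` (integer logarithm). [folklore] -/
theorem natLog_two_le (n : ℕ) : (Nat.log 2 n : ℝ) ≤ 2 * Real.log n := by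
  rcases Nat.eq_zero_or_pos n with rfl | hn
  · simp
  have h := Nat.pow_log_le_self 2 hn.ne'
  have h' : (2 : ℝ) ^ Nat.log 2 n ≤ n := by exact_mod_cast h
  have hlog := Real.log_le_log (by positivity) h'
  rw [Real.log_pow] at hlog
  have h2 := Real.log_two_gt_d9
  nlinarith [Nat.cast_nonneg (α := ℝ) (Nat.log 2 n)]

/-- `log 32 ≤ 4` and `log 4 ≤ 2`. [folklore] -/
theorem log_thirtytwo_le : Real.log 32 ≤ 4 ∧ Real.log 4 ≤ 2 := by
  have h2 := Real.log_two_lt_d9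
  constructor
  · rw [show (32 : ℝ) = 2 ^ 5 by norm_num, Real.log_pow]; push_cast; linarith
  · rw [show (4 : ℝ) = 2 ^ 2 by norm_num, Real.log_pow]; push_cast; linarith

/-- `Σ_{j = j₀}^{j₁} 2^{-j} ≤ 2 · 2^{-j₀}`. [folklore] -/
theorem sum_Icc_inv_two_pow_le (j₀ j₁ : ℕ) :
    ∑ j ∈ Icc j₀ j₁, ((2 : ℝ) ^ j)⁻¹ ≤ 2 * ((2 : ℝ) ^ j₀)⁻¹ := by
  rcases lt_or_ge j₁ j₀ with h | h
  · rw [Icc_eq_empty_of_lt h, sum_empty]; positivity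
  rw [← Finset.Ico_succ_right_eq_Icc, Finset.sum_Ico_eq_sum_range]
  calc ∑ k ∈ range (j₁ + 1 - j₀), ((2 : ℝ) ^ (j₀ + k))⁻¹
      = ((2 : ℝ) ^ j₀)⁻¹ * ∑ k ∈ range (j₁ + 1 - j₀), (1 / (2 : ℝ)) ^ k := by
        rw [mul_sum]; refine sum_congr rfl fun k _ => ?_
        rw [pow_add, mul_inv, one_div, inv_pow]
    _ ≤ ((2 : ℝ) ^ j₀)⁻¹ * 2 :=
        mul_le_mul_of_nonneg_left (sum_geometric_two_le _) (by positivity)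
    _ = 2 * ((2 : ℝ) ^ j₀)⁻¹ := by ring

/-- **Powers of `log x` lose to `x^η`**: eventually `C (log x)^c ≤ x^η`. [folklore] -/
theorem eventually_log_rpow_le_rpow (c : ℝ) {η : ℝ} (hη : 0 < η) {C : ℝ} (hC : 0 < C) :
    ∀ᶠ x : ℝ in atTop, C * Real.log x ^ c ≤ x ^ η := by
  have h := (isLittleO_log_rpow_rpow_atTop c hη).bound (inv_pos.mpr hC)
  filter_upwards [h, eventually_ge_atTop 1] with x hx hx1
  rw [Real.norm_of_nonneg (Real.rpow_nonneg (Real.log_nonneg hx1) c),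
    Real.norm_of_nonneg (Real.rpow_nonneg (by linarith) η)] at hx
  calc C * Real.log x ^ c ≤ C * (C⁻¹ * x ^ η) := mul_le_mul_of_nonneg_left hx hC.le
    _ = x ^ η := by field_simp

/-- **Powers of `log x` lose to `P ≥ exp((log log x)²)`**: eventually, for every `P > 0` with
`(log log x)² ≤ log P`, `C (log x)^c ≤ P` ((5.24) is automatic). [cite: FriedlanderIwaniecAnnals1998, (5.24)] -/
theorem eventually_log_rpow_le_P (c : ℝ) {C : ℝ} (hC : 0 < C) :
    ∀ᶠ x : ℝ in atTop, ∀ P : ℝ, 0 < P → Real.log (Real.log x) ^ 2 ≤ Real.log P →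
      C * Real.log x ^ c ≤ P := by
  have hll : Tendsto (fun x : ℝ => Real.log (Real.log x)) atTop atTop :=
    Real.tendsto_log_atTop.comp Real.tendsto_log_atTop
  filter_upwards [hll.eventually_ge_atTop (|c| + |Real.log C| + 1),
    Real.tendsto_log_atTop.eventually_gt_atTop 0] with x hu hlx P hP hlogP
  set u := Real.log (Real.log x) with hu'
  have hu1 : 1 ≤ u := by linarith [abs_nonneg c, abs_nonneg (Real.log C)]
  have hkey : Real.log C + c * u ≤ u ^ 2 := by
    have h1 : c * u ≤ |c| * u := mul_le_mul_of_nonneg_right (le_abs_self c) (by linarith)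
    have h2 : Real.log C ≤ |Real.log C| * u := by
      calc Real.log C ≤ |Real.log C| := le_abs_self _
        _ = |Real.log C| * 1 := (mul_one _).symm
        _ ≤ |Real.log C| * u := mul_le_mul_of_nonneg_left hu1 (abs_nonneg _)
    nlinarith [abs_nonneg c, abs_nonneg (Real.log C)]
  have hexp : C * Real.log x ^ c = Real.exp (Real.log C + c * u) := by
    rw [Real.exp_add, Real.exp_log hC, Real.rpow_def_of_pos hlx, hu', mul_comm c]
  rw [hexp]
  calc Real.exp (Real.log C + c * u) ≤ Real.exp (u ^ 2) := Real.exp_le_exp.mpr hkey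
    _ ≤ Real.exp (Real.log P) := Real.exp_le_exp.mpr hlogP
    _ = P := Real.exp_log hP

/-! ### (5.20) from (5.25) -/

set_option maxHeartbeats 1600000 in
/-- **(5.20) ⇐ (5.25)** [(5.21)–(5.24) of the source]: in the regime of (5.15) (with `A₁ ≤ 2B`, so
that `N ≤ M`), if `𝒟*(M, N) ≤ K ϑ² θ⁴ M^{1/2} N^{3/2} (log MN)⁸` for all large `x` then
`𝒟(M, N) ≤ (K + 1) ϑ² θ⁴ M^{1/2} N^{3/2} (log MN)⁸` for all large `x`: by (5.22)
(`abs_fiDispersion_sub_coprime_le`, `noncoprimeE_le`, `lemma51Count_block_le`) the difference is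
`≤ τ² K' (log x)^{κ+2} ((MN)^{3/4} + P⁻¹ M^{1/2} N^{3/2})`, and both terms are eventually
`≤ ½ ϑ² θ⁴ M^{1/2} N^{3/2}` ((5.23): `(MN)^{3/4} ≤ x^{-η} M^{1/2} N^{3/2}`; (5.24): `log P ≥ (log log x)²`).
[cite: FriedlanderIwaniecAnnals1998, (5.20)-(5.25)] -/
theorem dispersionBoundWith_of_coprime {η A A₁ A' t B K : ℝ} (hη : 0 < η)
    (hA' : 0 ≤ A') (ht : 0 ≤ t) (hB : 0 ≤ B) (hAB : A₁ ≤ 2 * B)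
    (h : CoprimeDispersionBoundWith η A A₁ A' t B K) : DispersionBoundWith η A A₁ A' t B (K + 1) := by
  obtain ⟨K₅, hK₅, κ, hblock⟩ := lemma51Count_block_le
  set c₁ : ℝ := 2 * t + 2 * A + 4 * A' + ((κ + 2 : ℕ) : ℝ) with hc₁
  set c₂ : ℝ := 2 * t + 2 * A + 4 * A' + ((κ + 1 : ℕ) : ℝ) with hc₂
  have ev1 := eventually_log_rpow_le_rpow c₁ hη (C := 280 * 2 ^ κ * K₅) (by positivity)
  have ev2 := eventually_log_rpow_le_P c₂ (C := 160 * 2 ^ κ * K₅) (by positivity)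
  have ev3 := eventually_log_rpow_le_rpow A₁ one_pos (C := Real.exp 1) (Real.exp_pos 1)
  unfold DispersionBoundWith
  filter_upwards [h, ev1, ev2, ev3, eventually_ge_atTop (Real.exp 1)] with x hx hx1 hx2 hx3 hxe
    P N M C N' hR p hp z₀ φ q hq
  -- notation and sizes of the parameters
  have he1 : 1 ≤ Real.exp 1 := by have := Real.add_one_le_exp (1 : ℝ); linarith
  have hx1' : 1 ≤ x := he1.trans hxe
  have hx0 : 0 < x := by linarith
  set ℓ := Real.log x with hℓ
  have hℓ1 : 1 ≤ ℓ := by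
    rw [hℓ, ← Real.log_exp 1]; exact Real.log_le_log (Real.exp_pos 1) hxe
  have hℓ0 : 0 < ℓ := by linarith
  set ϑ := ℓ ^ (-A) with hϑ
  set θ := ℓ ^ (-A') with hθ
  set τ := ℓ ^ t with hτ
  have hθ0 : 0 < θ := Real.rpow_pos_of_pos hℓ0 _
  have hθ1 : θ ≤ 1 := Real.rpow_le_one_of_one_le_of_nonpos hℓ1 (by linarith)
  have hϑ0 : 0 < ϑ := Real.rpow_pos_of_pos hℓ0 _
  have hτ1 : 1 ≤ τ := Real.one_le_rpow hℓ1 ht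
  have hτ0 : 0 ≤ τ := by linarith
  have hP := hR.P_pos
  have hN1 : 1 ≤ N := le_trans (Real.one_le_rpow hx1' (by linarith)) hR.N_gt.le
  have hN0 : 0 < N := by linarith
  have hMNx : M * N < x := hR.MN_lt
  have hℓA : 0 < ℓ ^ A₁ := Real.rpow_pos_of_pos hℓ0 _
  have hMN1 : Real.exp 1 ≤ M * N := by
    have h2 : x / ℓ ^ A₁ < M * N := hR.MN_gt
    rw [div_lt_iff₀ hℓA] at h2
    have hx3' : Real.exp 1 * ℓ ^ A₁ ≤ x := by simpa [Real.rpow_one] using hx3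
    by_contra hcon
    push Not at hcon
    have := mul_lt_mul_of_pos_right hcon hℓA
    exact absurd (h2.trans (this.trans_le hx3')) (lt_irrefl x)
  have hMN0 : 0 < M * N := lt_of_lt_of_le (Real.exp_pos 1) hMN1
  have hM0 : 0 < M := (mul_pos_iff_of_pos_right hN0).mp hMN0
  have hxhalf : x ^ (1 / 2 : ℝ) ≤ x := by
    calc x ^ (1 / 2 : ℝ) ≤ x ^ (1 : ℝ) := Real.rpow_le_rpow_of_exponent_le hx1' (by norm_num)
      _ = x := Real.rpow_one x
  have hℓB1 : 1 ≤ ℓ ^ B := Real.one_le_rpow hℓ1 hB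
  have hNx : N ≤ x := by
    have h1 : N < x ^ (1 / 2 : ℝ) / ℓ ^ B := hR.N_lt
    have h2 : x ^ (1 / 2 : ℝ) / ℓ ^ B ≤ x ^ (1 / 2 : ℝ) := div_le_self (by positivity) hℓB1
    linarith
  have hNM : N ≤ M := by
    have h1 : N < x ^ (1 / 2 : ℝ) / ℓ ^ B := hR.N_lt
    have h2 : x / ℓ ^ A₁ < M * N := hR.MN_gt
    have hsq : (x ^ (1 / 2 : ℝ) / ℓ ^ B) ^ 2 = x / ℓ ^ (2 * B) := by
      rw [div_pow, ← Real.rpow_natCast (x ^ (1 / 2 : ℝ)) 2, ← Real.rpow_mul hx0.le,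
        ← Real.rpow_natCast (ℓ ^ B) 2, ← Real.rpow_mul hℓ0.le]
      norm_num; rw [mul_comm B 2]
    have h3 : x / ℓ ^ (2 * B) ≤ x / ℓ ^ A₁ :=
      div_le_div_of_nonneg_left hx0.le hℓA (Real.rpow_le_rpow_of_exponent_le hℓ1 hAB)
    have h4 : N ^ 2 < M * N := by
      calc N ^ 2 ≤ (x ^ (1 / 2 : ℝ) / ℓ ^ B) ^ 2 := pow_le_pow_left₀ hN0.le h1.le 2
        _ = x / ℓ ^ (2 * B) := hsq
        _ ≤ x / ℓ ^ A₁ := h3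
        _ < M * N := h2
    nlinarith
  have hM1 : 1 ≤ M := hN1.trans hNM
  have hlogMN1 : 1 ≤ Real.log (M * N) := by
    rw [← Real.log_exp 1]; exact Real.log_le_log (Real.exp_pos 1) hMN1
  have hlogMN_le : Real.log (M * N) ≤ ℓ := Real.log_le_log hMN0 hMNx.le
  -- the two inputs
  have hcop := hx P N M C N' hR p hp z₀ φ q hq
  have hdiff := abs_fiDispersion_sub_coprime_le hq.bound hp.bound z₀ hM0 N' θ C P hτ0
  set W := M ^ (1 / 2 : ℝ) * N ^ (3 / 2 : ℝ) with hW
  set L8 := Real.log (M * N) ^ 8 with hL8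
  have hW0 : 0 < W := by positivity
  have hL81 : 1 ≤ L8 := one_le_pow₀ hlogMN1
  have hmain0 : 0 ≤ ϑ ^ 2 * θ ^ 4 * W := by positivity
  suffices hE : τ ^ 2 * (noncoprimeE q p z₀ M N' θ C P τ : ℝ) ≤ ϑ ^ 2 * θ ^ 4 * W by
    have h1 := (abs_le.mp hdiff).2
    have h2 : ϑ ^ 2 * θ ^ 4 * W ≤ ϑ ^ 2 * θ ^ 4 * W * L8 := le_mul_of_one_le_right hmain0 hL81
    calc fiDispersion q p z₀ M N' θ C P τ
        ≤ fiDispersionCoprime q p z₀ M N' θ C P τ + τ ^ 2 * (noncoprimeE q p z₀ M N' θ C P τ : ℝ) := by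
          linarith
      _ ≤ K * ϑ ^ 2 * θ ^ 4 * W * L8 + ϑ ^ 2 * θ ^ 4 * W * L8 := add_le_add hcop (hE.trans h2)
      _ = (K + 1) * ϑ ^ 2 * θ ^ 4 * W * L8 := by ring
  -- the combinatorial bound
  set M₀ := ⌊4 * M⌋₊ with hM₀
  set N₀ := ⌊(1 + θ) * N'⌋₊ with hN₀
  set j₀ := Nat.log 2 ⌈P⌉₊ with hj₀
  set j₁ := Nat.log 2 N₀ with hj₁
  have hE1 := noncoprimeE_le q p z₀ M N' θ C P τ
  have hM₀le : (M₀ : ℝ) ≤ 4 * M := Nat.floor_le (by positivity)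
  have hM₀ge : 4 * M - 1 ≤ (M₀ : ℝ) := by
    have := Nat.lt_floor_add_one (4 * M); rw [← hM₀] at this; linarith
  have hN'1 := hR.N'_gt
  have hN'2 := hR.N'_lt
  have hN₀le : (N₀ : ℝ) ≤ 4 * N := by
    calc (N₀ : ℝ) ≤ (1 + θ) * N' := Nat.floor_le (by nlinarith)
      _ ≤ 2 * (2 * N) := by nlinarith
      _ = 4 * N := by ring
  have hN₀1 : 1 ≤ N₀ := by
    rw [hN₀]; refine Nat.le_floor ?_; push_cast; nlinarith
  have hN₀x : (N₀ : ℝ) ≤ 4 * x := by linarith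
  -- per block
  have hJ : ∀ j ∈ Icc j₀ j₁,
      (((2 * Nat.log 2 (2 ^ (j + 1) * M₀) * lemma51Count (radM M₀ j) (radN N₀ j) : ℕ)) : ℝ) ≤
        4 * (4 + ℓ) * (K₅ * ((M * N) ^ (3 / 4 : ℝ) + W / 2 ^ j) * (1 + Real.log (M * N)) ^ κ) := by
    intro j hj
    have hj1 : j ≤ j₁ := (mem_Icc.mp hj).2
    have h2jN₀ : 2 ^ j ≤ N₀ :=
      (Nat.pow_le_pow_right (by norm_num) hj1).trans (Nat.pow_log_le_self 2 (by omega))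
    have h2j : (2 : ℝ) ^ j ≤ 4 * N := le_trans (by exact_mod_cast h2jN₀) hN₀le
    have hNM₀ : N₀ ≤ 2 ^ (j + 1) * M₀ := by
      have h2j1 : (1 : ℝ) ≤ 2 ^ j := one_le_pow₀ (by norm_num)
      have : (N₀ : ℝ) ≤ 2 ^ (j + 1) * M₀ := by
        calc (N₀ : ℝ) ≤ 4 * N := hN₀le
          _ ≤ 2 * (4 * M - 1) := by nlinarith
          _ ≤ 2 * M₀ := by linarith
          _ ≤ 2 ^ (j + 1) * M₀ := by
              rw [pow_succ]
              have hM₀0 : (0 : ℝ) ≤ M₀ := Nat.cast_nonneg _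
              nlinarith
      exact_mod_cast this
    have hL := hblock M N hN1 hNM M₀ N₀ j hM₀le hN₀le hNM₀ h2j
    have hL0 : 0 ≤ K₅ * ((M * N) ^ (3 / 4 : ℝ) + W / 2 ^ j) * (1 + Real.log (M * N)) ^ κ := by
      positivity
    -- the multiplicity
    have hmult : ((Nat.log 2 (2 ^ (j + 1) * M₀) : ℕ) : ℝ) ≤ 2 * (4 + ℓ) := by
      set n := 2 ^ (j + 1) * M₀ with hn
      have hnle : (n : ℝ) ≤ 32 * x := by
        rw [hn]; push_cast; rw [pow_succ]
        have : (2 : ℝ) ^ j * 2 * M₀ ≤ (4 * N) * 2 * (4 * M) := by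
          have hM₀0 : (0 : ℝ) ≤ M₀ := Nat.cast_nonneg _
          nlinarith [mul_le_mul h2j hM₀le hM₀0 (by positivity)]
        nlinarith
      rcases Nat.eq_zero_or_pos n with hn0 | hnpos
      · rw [hn0]; simp; linarith
      · calc ((Nat.log 2 n : ℕ) : ℝ) ≤ 2 * Real.log n := natLog_two_le n
          _ ≤ 2 * Real.log (32 * x) :=
              mul_le_mul_of_nonneg_left (Real.log_le_log (by exact_mod_cast hnpos) hnle) (by norm_num)
          _ = 2 * (Real.log 32 + ℓ) := by rw [Real.log_mul (by norm_num) hx0.ne']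
          _ ≤ 2 * (4 + ℓ) := by linarith [log_thirtytwo_le.1]
    push_cast
    calc 2 * ((Nat.log 2 (2 ^ (j + 1) * M₀) : ℕ) : ℝ) * (lemma51Count (radM M₀ j) (radN N₀ j) : ℝ)
        ≤ 2 * (2 * (4 + ℓ)) * (K₅ * ((M * N) ^ (3 / 4 : ℝ) + W / 2 ^ j) * (1 + Real.log (M * N)) ^ κ) :=
          mul_le_mul (by linarith) hL (Nat.cast_nonneg _) (by positivity)
      _ = 4 * (4 + ℓ) * (K₅ * ((M * N) ^ (3 / 4 : ℝ) + W / 2 ^ j) * (1 + Real.log (M * N)) ^ κ) := by ring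
  -- sum over the blocks
  have hsum : (noncoprimeE q p z₀ M N' θ C P τ : ℝ) ≤
      4 * (4 + ℓ) * K₅ * (1 + Real.log (M * N)) ^ κ *
        (#(Icc j₀ j₁) * (M * N) ^ (3 / 4 : ℝ) + W * ∑ j ∈ Icc j₀ j₁, ((2 : ℝ) ^ j)⁻¹) := by
    calc (noncoprimeE q p z₀ M N' θ C P τ : ℝ)
        ≤ ((∑ j ∈ Icc j₀ j₁, 2 * Nat.log 2 (2 ^ (j + 1) * M₀) * lemma51Count (radM M₀ j) (radN N₀ j) : ℕ) : ℝ) := by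
          exact_mod_cast hE1
      _ = ∑ j ∈ Icc j₀ j₁, (((2 * Nat.log 2 (2 ^ (j + 1) * M₀) * lemma51Count (radM M₀ j) (radN N₀ j) : ℕ)) : ℝ) := by
          rw [Nat.cast_sum]
      _ ≤ ∑ j ∈ Icc j₀ j₁, 4 * (4 + ℓ) * (K₅ * ((M * N) ^ (3 / 4 : ℝ) + W / 2 ^ j) * (1 + Real.log (M * N)) ^ κ) :=
          sum_le_sum hJ
      _ = 4 * (4 + ℓ) * K₅ * (1 + Real.log (M * N)) ^ κ *
            (#(Icc j₀ j₁) * (M * N) ^ (3 / 4 : ℝ) + W * ∑ j ∈ Icc j₀ j₁, ((2 : ℝ) ^ j)⁻¹) := by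
          have e : ∀ j ∈ Icc j₀ j₁,
              4 * (4 + ℓ) * (K₅ * ((M * N) ^ (3 / 4 : ℝ) + W / 2 ^ j) * (1 + Real.log (M * N)) ^ κ) =
              4 * (4 + ℓ) * K₅ * (1 + Real.log (M * N)) ^ κ * (M * N) ^ (3 / 4 : ℝ) +
                4 * (4 + ℓ) * K₅ * (1 + Real.log (M * N)) ^ κ * W * ((2 : ℝ) ^ j)⁻¹ := by
            intro j _; rw [div_eq_mul_inv]; ring
          rw [sum_congr rfl e, sum_add_distrib, sum_const, nsmul_eq_mul, ← mul_sum]; ring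
  have hcardJ : (#(Icc j₀ j₁) : ℝ) ≤ 7 * ℓ := by
    have h1 : #(Icc j₀ j₁) ≤ j₁ + 1 := by rw [Nat.card_Icc]; omega
    have hj₁ : (j₁ : ℝ) ≤ 2 * (2 + ℓ) := by
      calc (j₁ : ℝ) ≤ 2 * Real.log N₀ := natLog_two_le N₀
        _ ≤ 2 * Real.log (4 * x) :=
            mul_le_mul_of_nonneg_left (Real.log_le_log (by exact_mod_cast hN₀1) hN₀x) (by norm_num)
        _ = 2 * (Real.log 4 + ℓ) := by rw [Real.log_mul (by norm_num) hx0.ne']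
        _ ≤ 2 * (2 + ℓ) := by linarith [log_thirtytwo_le.2]
    calc (#(Icc j₀ j₁) : ℝ) ≤ j₁ + 1 := by exact_mod_cast h1
      _ ≤ 7 * ℓ := by linarith
  have hgeo : ∑ j ∈ Icc j₀ j₁, ((2 : ℝ) ^ j)⁻¹ ≤ 4 / P := by
    have h1 := sum_Icc_inv_two_pow_le j₀ j₁
    have h2 : P < 2 ^ (j₀ + 1) := by
      have := Nat.lt_pow_succ_log_self (b := 2) (by norm_num) ⌈P⌉₊
      calc P ≤ ⌈P⌉₊ := Nat.le_ceil P
        _ < ((2 ^ (Nat.log 2 ⌈P⌉₊ + 1) : ℕ) : ℝ) := by exact_mod_cast this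
        _ = 2 ^ (j₀ + 1) := by rw [hj₀]; push_cast; ring
    have h3 : 2 * ((2 : ℝ) ^ j₀)⁻¹ ≤ 4 / P := by
      rw [show 2 * ((2 : ℝ) ^ j₀)⁻¹ = 4 / 2 ^ (j₀ + 1) by rw [pow_succ]; field_simp; ring]
      exact div_le_div_of_nonneg_left (by norm_num) hP h2.le
    exact h1.trans h3
  -- simplify the logarithms
  have hLκ : (1 + Real.log (M * N)) ^ κ ≤ 2 ^ κ * ℓ ^ κ := by
    rw [← mul_pow]; exact pow_le_pow_left₀ (by linarith) (by linarith) κ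
  have hE2 : (noncoprimeE q p z₀ M N' θ C P τ : ℝ) ≤
      140 * 2 ^ κ * K₅ * ℓ ^ (κ + 2) * (M * N) ^ (3 / 4 : ℝ) + 80 * 2 ^ κ * K₅ * ℓ ^ (κ + 1) * W / P := by
    have ha0 : 0 ≤ (M * N) ^ (3 / 4 : ℝ) := by positivity
    have hs0 : 0 ≤ ∑ j ∈ Icc j₀ j₁, ((2 : ℝ) ^ j)⁻¹ := sum_nonneg fun _ _ => by positivity
    calc (noncoprimeE q p z₀ M N' θ C P τ : ℝ)
        ≤ 4 * (4 + ℓ) * K₅ * (1 + Real.log (M * N)) ^ κ *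
            (#(Icc j₀ j₁) * (M * N) ^ (3 / 4 : ℝ) + W * ∑ j ∈ Icc j₀ j₁, ((2 : ℝ) ^ j)⁻¹) := hsum
      _ ≤ 4 * (5 * ℓ) * K₅ * (2 ^ κ * ℓ ^ κ) * (7 * ℓ * (M * N) ^ (3 / 4 : ℝ) + W * (4 / P)) := by
          have e1 : 4 + ℓ ≤ 5 * ℓ := by linarith
          have e2 : (#(Icc j₀ j₁) : ℝ) * (M * N) ^ (3 / 4 : ℝ) ≤ 7 * ℓ * (M * N) ^ (3 / 4 : ℝ) :=
            mul_le_mul_of_nonneg_right hcardJ ha0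
          have e3 : W * ∑ j ∈ Icc j₀ j₁, ((2 : ℝ) ^ j)⁻¹ ≤ W * (4 / P) := mul_le_mul_of_nonneg_left hgeo hW0.le
          have e4 : 0 ≤ (1 + Real.log (M * N)) ^ κ := by positivity
          have eS := add_le_add e2 e3
          have hS0 : 0 ≤ (#(Icc j₀ j₁) : ℝ) * (M * N) ^ (3 / 4 : ℝ) + W * ∑ j ∈ Icc j₀ j₁, ((2 : ℝ) ^ j)⁻¹ := by
            positivity
          refine mul_le_mul (mul_le_mul (mul_le_mul_of_nonneg_right (by linarith) hK₅.le) hLκ e4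
            (by positivity)) eS hS0 (by positivity)
      _ = 140 * 2 ^ κ * K₅ * ℓ ^ (κ + 2) * (M * N) ^ (3 / 4 : ℝ) + 80 * 2 ^ κ * K₅ * ℓ ^ (κ + 1) * W / P := by
          field_simp; ring
  -- exponent bookkeeping: τ² ℓ^{κ+m} = ϑ² θ⁴ ℓ^{2t+2A+4A'+κ+m}
  have hpow : ∀ m : ℕ, τ ^ 2 * ℓ ^ (κ + m) =
      ϑ ^ 2 * θ ^ 4 * ℓ ^ (2 * t + 2 * A + 4 * A' + ((κ + m : ℕ) : ℝ)) := by
    intro m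
    rw [hτ, hϑ, hθ, ← Real.rpow_natCast ℓ (κ + m), ← Real.rpow_natCast (ℓ ^ t) 2,
      ← Real.rpow_natCast (ℓ ^ (-A)) 2, ← Real.rpow_natCast (ℓ ^ (-A')) 4,
      ← Real.rpow_mul hℓ0.le, ← Real.rpow_mul hℓ0.le, ← Real.rpow_mul hℓ0.le,
      ← Real.rpow_add hℓ0, ← Real.rpow_add hℓ0, ← Real.rpow_add hℓ0]
    congr 1; push_cast; ring
  -- term (i)
  have hWlow : x ^ η * (M * N) ^ (3 / 4 : ℝ) ≤ W := by
    have e1 : (M * N) ^ (3 / 4 : ℝ) = (M * N) ^ (1 / 2 : ℝ) * (M * N) ^ (1 / 4 : ℝ) := by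
      rw [← Real.rpow_add hMN0]; norm_num
    have e2 : (M * N) ^ (1 / 4 : ℝ) ≤ x ^ (1 / 4 : ℝ) := Real.rpow_le_rpow hMN0.le hMNx.le (by norm_num)
    have e3 : x ^ η * x ^ (1 / 4 : ℝ) = x ^ (1 / 4 + η) := by rw [← Real.rpow_add hx0]; ring_nf
    have e4 : x ^ (1 / 4 + η) ≤ N := hR.N_gt.le
    have e5 : (M * N) ^ (1 / 2 : ℝ) * N = W := by
      rw [hW, Real.mul_rpow hM0.le hN0.le, show (3 / 2 : ℝ) = 1 / 2 + 1 by norm_num,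
        Real.rpow_add hN0, Real.rpow_one]; ring
    have h0 : 0 ≤ (M * N) ^ (1 / 2 : ℝ) := by positivity
    calc x ^ η * (M * N) ^ (3 / 4 : ℝ) = (M * N) ^ (1 / 2 : ℝ) * (x ^ η * (M * N) ^ (1 / 4 : ℝ)) := by
          rw [e1]; ring
      _ ≤ (M * N) ^ (1 / 2 : ℝ) * (x ^ η * x ^ (1 / 4 : ℝ)) := by gcongr
      _ = (M * N) ^ (1 / 2 : ℝ) * x ^ (1 / 4 + η) := by rw [e3]
      _ ≤ (M * N) ^ (1 / 2 : ℝ) * N := mul_le_mul_of_nonneg_left e4 h0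
      _ = W := e5
  have hterm1 : τ ^ 2 * (140 * 2 ^ κ * K₅ * ℓ ^ (κ + 2) * (M * N) ^ (3 / 4 : ℝ)) ≤
      ϑ ^ 2 * θ ^ 4 * W / 2 := by
    have h1 : 280 * 2 ^ κ * K₅ * ℓ ^ c₁ ≤ x ^ η := hx1
    have ha0 : 0 ≤ (M * N) ^ (3 / 4 : ℝ) := by positivity
    have hvv : 0 ≤ ϑ ^ 2 * θ ^ 4 := by positivity
    calc τ ^ 2 * (140 * 2 ^ κ * K₅ * ℓ ^ (κ + 2) * (M * N) ^ (3 / 4 : ℝ))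
        = (τ ^ 2 * ℓ ^ (κ + 2)) * (140 * 2 ^ κ * K₅) * (M * N) ^ (3 / 4 : ℝ) := by ring
      _ = ϑ ^ 2 * θ ^ 4 * ((280 * 2 ^ κ * K₅ * ℓ ^ c₁) * (M * N) ^ (3 / 4 : ℝ)) / 2 := by
          rw [hpow 2, hc₁]; ring
      _ ≤ ϑ ^ 2 * θ ^ 4 * (x ^ η * (M * N) ^ (3 / 4 : ℝ)) / 2 := by
          gcongr
      _ ≤ ϑ ^ 2 * θ ^ 4 * W / 2 := by gcongr
  -- term (ii)
  have hterm2 : τ ^ 2 * (80 * 2 ^ κ * K₅ * ℓ ^ (κ + 1) * W / P) ≤ ϑ ^ 2 * θ ^ 4 * W / 2 := by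
    have h1 : 160 * 2 ^ κ * K₅ * ℓ ^ c₂ ≤ P := hx2 P hP hR.logP_ge
    have hvv : 0 ≤ ϑ ^ 2 * θ ^ 4 * W := by positivity
    calc τ ^ 2 * (80 * 2 ^ κ * K₅ * ℓ ^ (κ + 1) * W / P)
        = (τ ^ 2 * ℓ ^ (κ + 1)) * (80 * 2 ^ κ * K₅) * W / P := by ring
      _ = ϑ ^ 2 * θ ^ 4 * W * ((160 * 2 ^ κ * K₅ * ℓ ^ c₂) / P) / 2 := by
          rw [hpow 1, hc₂]; ring
      _ ≤ ϑ ^ 2 * θ ^ 4 * W * 1 / 2 := by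
          gcongr
          rw [div_le_one hP]; exact h1
      _ = ϑ ^ 2 * θ ^ 4 * W / 2 := by ring
  -- conclusion
  calc τ ^ 2 * (noncoprimeE q p z₀ M N' θ C P τ : ℝ)
      ≤ τ ^ 2 * (140 * 2 ^ κ * K₅ * ℓ ^ (κ + 2) * (M * N) ^ (3 / 4 : ℝ) +
          80 * 2 ^ κ * K₅ * ℓ ^ (κ + 1) * W / P) := mul_le_mul_of_nonneg_left hE2 (by positivity)
    _ = τ ^ 2 * (140 * 2 ^ κ * K₅ * ℓ ^ (κ + 2) * (M * N) ^ (3 / 4 : ℝ)) +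
          τ ^ 2 * (80 * 2 ^ κ * K₅ * ℓ ^ (κ + 1) * W / P) := by ring
    _ ≤ ϑ ^ 2 * θ ^ 4 * W / 2 + ϑ ^ 2 * θ ^ 4 * W / 2 := add_le_add hterm1 hterm2
    _ = ϑ ^ 2 * θ ^ 4 * W := by ring

/-- The regime shrinks as `B` grows (for `log x ≥ 1`). [folklore] -/
theorem FISectorRegime.of_le {η A₁ B B' x P N M C N' : ℝ} (hBB' : B ≤ B') (hx : 1 ≤ Real.log x)
    (hx0 : 0 ≤ x) (h : FISectorRegime η A₁ B' x P N M C N') : FISectorRegime η A₁ B x P N M C N' where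
  P_pos := h.P_pos
  logP_ge := h.logP_ge
  logP_le := h.logP_le
  N_gt := h.N_gt
  N_lt := h.N_lt.trans_le (div_le_div_of_nonneg_left (Real.rpow_nonneg hx0 _)
    (Real.rpow_pos_of_pos (by linarith) _) (Real.rpow_le_rpow_of_exponent_le hx hBB'))
  MN_gt := h.MN_gt
  MN_lt := h.MN_lt
  C_ge := h.C_ge
  C_le := h.C_le
  N'_gt := h.N'_gt
  N'_lt := h.N'_lt

/-- (5.25) for `B` gives (5.25) for every `B' ≥ B`. [folklore] -/
theorem CoprimeDispersionBoundWith.mono {η A A₁ A' t B B' K : ℝ} (hBB' : B ≤ B')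
    (h : CoprimeDispersionBoundWith η A A₁ A' t B K) : CoprimeDispersionBoundWith η A A₁ A' t B' K := by
  unfold CoprimeDispersionBoundWith at h ⊢
  filter_upwards [h, eventually_ge_atTop (Real.exp 1)] with x hx hxe P N M C N' hR p hp z₀ φ q hq
  have hx1 : 1 ≤ Real.log x := by
    rw [← Real.log_exp 1]; exact Real.log_le_log (Real.exp_pos 1) hxe
  exact hx P N M C N' (hR.of_le hBB' hx1 (le_trans (Real.exp_pos 1).le hxe)) p hp z₀ φ q hq

/-- **(5.20) from (5.25), quantified form**: if for every `η, A, A₁ > 0` there are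
`A' ≥ 2A + 2^20`, `t ≥ A + 124`, `B > 0`, `K > 0` with (5.25), then the same holds with (5.20)
(`B ↦ max B A₁`, `K ↦ K + 1`); with `bilinear515_of_dispersion` this puts (5.15) on (5.25).
[cite: FriedlanderIwaniecAnnals1998, (5.20)-(5.25)] -/
theorem dispersion_of_coprime
    (h : ∀ η : ℝ, 0 < η → ∀ A : ℝ, 0 < A → ∀ A₁ : ℝ, 0 < A₁ →
      ∃ A' t B K : ℝ, 2 * A + 2 ^ 20 ≤ A' ∧ A + 124 ≤ t ∧ 0 < B ∧ 0 < K ∧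
        CoprimeDispersionBoundWith η A A₁ A' t B K) :
    ∀ η : ℝ, 0 < η → ∀ A : ℝ, 0 < A → ∀ A₁ : ℝ, 0 < A₁ →
      ∃ A' t B K : ℝ, 2 * A + 2 ^ 20 ≤ A' ∧ A + 124 ≤ t ∧ 0 < B ∧ 0 < K ∧
        DispersionBoundWith η A A₁ A' t B K := by
  intro η hη A hA A₁ hA₁
  obtain ⟨A', t, B, K, hA', ht, hB, hK, hC⟩ := h η hη A hA A₁ hA₁
  refine ⟨A', t, max B A₁, K + 1, hA', ht, lt_max_of_lt_left hB, by linarith, ?_⟩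
  refine dispersionBoundWith_of_coprime hη (by linarith) (by linarith) (le_max_of_le_left hB.le) ?_
    (hC.mono (le_max_left B A₁))
  linarith [le_max_right B A₁]

end Literature.NumberTheory.Sieve.FriedlanderIwaniecPrimes

end
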